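import Summits.RiemannHypothesis.RiemannHypothesis.Theorems.IntegerScrewScrewPolyFloorLandauWindowSharp
import Literature.NumberTheory.LFunctions.ZetaArgBacklundExplicit
import Literature.NumberTheory.LFunctions.VinogradovKorobovFarZerosTail
import HarnessLib

/-!
# Integer screw ladder — EXPLICIT window counts for the zeros of `ζ` (`T ≥ 30`) and the sharp Landau pairing window
# with explicit threshold `T* = 30` (RH-free, F1-free)

Cell rh-split, seat rh-split-screw-finite g4 (brief sha16 f79c5f09d8bcb036), card `run/shared/lean/pub/rh-split/cards/SPLIT-screw-finite.md`
§11 (gen-4 addendum, correction C1 of the g3 note «T* INEFFECTIVE in kind»): zero-definition raw form of §1 of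
`HOME/rh-split-screw-finite/SketchG4.lean` (sha16 b49cecec5c052716; proofs verbatim, the seat-local `BlockBound` /
`PairingWindow` abbreviations folded into the one theorem that used them), filed by rh-split-typer-1 g2 (seat's optional
def-free hand-on, 22:47Z).

* `zetaZeroCount_window_lower_explicit` / `_lower_four` / `zetaZeroCount_window_upper_explicit` /
  `zetaZeroCount_unit_window_le_explicit` — explicit two-sided counts of zeros in a window `[T₁, T₂]`, `30 ≤ T₁ ≤ T₂`, from the
  tree's PROVED `Literature.NumberTheory.LFunctions.abs_zetaZeroCount_sub_main_le_explicit`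
  (`|N(T) − (T/2π) log(T/2πe)| ≤ 0.3083 log T + 4.128`, Hasanalizade–Shen–Wong 2022);
* `pairing_window_positive_sharp_thirty` — the tree's `pairing_window_positive_sharp` (`∃ C T*, …`) with the height threshold
  made EXPLICIT, `T* = 30`; the remaining `∃` is the block constant `C = max C_B 8` of `pairing_window_lower_bound_sharp`.

Typer replay (rh-split-typer-1 g2): scratch rc 0 / 0 warnings / 0 sorry, `#print axioms pairing_window_positive_sharp_thirty`
= [propext, Classical.choice, Quot.sound]; this raw form re-checked the same.  HONEST LABEL: RH-free explicit-constant
bookkeeping for the screw ladder's finite side; nothing here bears on the truth of RH.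
-/

noncomputable section

open Complex Finset
open scoped Real

set_option linter.dupNamespace false

namespace Summit.RiemannHypothesis.RiemannHypothesis.Theorems.IntegerScrewLandau.WindowThirty

open Literature.NumberTheory.LFunctions
open Literature.NumberTheory.LFunctions.FarZeros (log_div_two_pi_e)
open Summit.RiemannHypothesis.RiemannHypothesis.Theorems.IntegerScrewLandau
open Summit.RiemannHypothesis.RiemannHypothesis.Theorems

/-! ## §1 Explicit window count (RH-free, F1-free, PROVED) -/

-- `log(T/(2πe)) = log(T/2π) − 1` is the landed `Literature.NumberTheory.LFunctions.FarZeros.log_div_two_pi_e`.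

/-- `3 ≤ log 30`. -/
theorem three_le_log_thirty : (3 : ℝ) ≤ Real.log 30 := by
  rw [Real.le_log_iff_exp_le (by norm_num)]
  have h := Real.exp_one_lt_d9
  have h0 := (Real.exp_pos 1).le
  have : Real.exp 3 = Real.exp 1 ^ 3 := by rw [Real.exp_one_pow]; norm_num
  rw [this]
  calc Real.exp 1 ^ 3 ≤ (2.7182818286 : ℝ) ^ 3 := pow_le_pow_left₀ h0 h.le 3
    _ ≤ 30 := by norm_num

/-- **Explicit zeros-in-a-window count** (`30 ≤ T₁ ≤ T₂`):
`N(T₂) − N(T₁) ≥ ((T₂ − T₁)/2π) log(T₁/2π) − (0.6166 log T₂ + 8.256)`, from the PROVED explicit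
Backlund bound `|N(T) − (T/2π)log(T/2πe)| ≤ 0.3083 log T + 4.128` (`T ≥ 30`,
`abs_zetaZeroCount_sub_main_le_explicit`, ZetaArgBacklundExplicit.lean) and the convexity lemma
`rvmMain_sub_ge`.  This is `zetaZeroCount_window_lower` with its `∃ C T₀` made explicit:
`(C, T₀) = (0.6166·log T₂ + 8.256 form; T₀ = 30)`. -/
theorem zetaZeroCount_window_lower_explicit {T₁ T₂ : ℝ} (h1 : 30 ≤ T₁) (h12 : T₁ ≤ T₂) :
    (T₂ - T₁) / (2 * π) * Real.log (T₁ / (2 * π)) - (0.6166 * Real.log T₂ + 8.256) ≤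
      (zetaZeroCount T₂ : ℝ) - zetaZeroCount T₁ := by
  have hT₁0 : 0 < T₁ := by linarith
  have hT₂0 : 0 < T₂ := by linarith
  have e1 := abs_zetaZeroCount_sub_main_le_explicit h1
  have e2 := abs_zetaZeroCount_sub_main_le_explicit (h1.trans h12)
  rw [log_div_two_pi_e hT₁0] at e1
  rw [log_div_two_pi_e hT₂0] at e2
  have hm := rvmMain_sub_ge hT₁0 h12
  have hlog12 : Real.log T₁ ≤ Real.log T₂ := Real.log_le_log hT₁0 h12
  obtain ⟨e1l, e1u⟩ := abs_le.1 e1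
  obtain ⟨e2l, e2u⟩ := abs_le.1 e2
  have r1 : T₁ / (2 * π) * (Real.log (T₁ / (2 * π)) - 1) =
      T₁ / (2 * π) * Real.log (T₁ / (2 * π)) - T₁ / (2 * π) := by ring
  have r2 : T₂ / (2 * π) * (Real.log (T₂ / (2 * π)) - 1) =
      T₂ / (2 * π) * Real.log (T₂ / (2 * π)) - T₂ / (2 * π) := by ring
  rw [r1] at e1l e1u
  rw [r2] at e2l e2u
  linarith

/-- The explicit window count in the `C·log T₂` shape of `zetaZeroCount_window_lower`, with
`(C, T*) = (4, 30)` (uses `log T₂ ≥ log 30 ≥ 3`). -/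
theorem zetaZeroCount_window_lower_four {T₁ T₂ : ℝ} (h1 : 30 ≤ T₁) (h12 : T₁ ≤ T₂) :
    (T₂ - T₁) / (2 * π) * Real.log (T₁ / (2 * π)) - 4 * Real.log T₂ ≤
      (zetaZeroCount T₂ : ℝ) - zetaZeroCount T₁ := by
  have h := zetaZeroCount_window_lower_explicit h1 h12
  have hlog : 3 ≤ Real.log T₂ :=
    three_le_log_thirty.trans (Real.log_le_log (by norm_num) (h1.trans h12))
  linarith

/-- Concavity companion of `rvmMain_sub_ge`: `f(T₂) − f(T₁) ≤ ((T₂ − T₁)/2π) log(T₂/2π)`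
(`log(T₂/T₁) ≤ T₂/T₁ − 1`). -/
theorem rvmMain_sub_le {T₁ T₂ : ℝ} (h1 : 0 < T₁) (h12 : T₁ ≤ T₂) :
    (T₂ / (2 * π) * Real.log (T₂ / (2 * π)) - T₂ / (2 * π)) -
        (T₁ / (2 * π) * Real.log (T₁ / (2 * π)) - T₁ / (2 * π)) ≤
      (T₂ - T₁) / (2 * π) * Real.log (T₂ / (2 * π)) := by
  have h2 : 0 < T₂ := lt_of_lt_of_le h1 h12
  have hπ : 0 < 2 * π := by positivity
  have hlog : Real.log (T₂ / (2 * π)) - Real.log (T₁ / (2 * π)) ≤ T₂ / T₁ - 1 := by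
    have h := Real.log_le_sub_one_of_pos (div_pos h2 h1)
    rw [← Real.log_div (by positivity) (by positivity), div_div_div_cancel_right₀ hπ.ne']
    exact h
  have key : T₁ / (2 * π) * (Real.log (T₂ / (2 * π)) - Real.log (T₁ / (2 * π))) -
      (T₂ - T₁) / (2 * π) ≤ 0 := by
    have h3 : T₁ / (2 * π) * (T₂ / T₁ - 1) = (T₂ - T₁) / (2 * π) := by
      field_simp
    rw [← h3]
    have h4 : 0 ≤ T₁ / (2 * π) := by positivity
    nlinarith [mul_le_mul_of_nonneg_left hlog h4]
  have e : (T₂ / (2 * π) * Real.log (T₂ / (2 * π)) - T₂ / (2 * π)) -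
        (T₁ / (2 * π) * Real.log (T₁ / (2 * π)) - T₁ / (2 * π)) -
      (T₂ - T₁) / (2 * π) * Real.log (T₂ / (2 * π)) =
      T₁ / (2 * π) * (Real.log (T₂ / (2 * π)) - Real.log (T₁ / (2 * π))) - (T₂ - T₁) / (2 * π) := by
    ring
  linarith [key, e]

/-- **Explicit zeros-in-a-window count, upper side** (`30 ≤ T₁ ≤ T₂`):
`N(T₂) − N(T₁) ≤ ((T₂ − T₁)/2π) log(T₂/2π) + 0.3083 (log T₁ + log T₂) + 8.256`. -/
theorem zetaZeroCount_window_upper_explicit {T₁ T₂ : ℝ} (h1 : 30 ≤ T₁) (h12 : T₁ ≤ T₂) :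
    (zetaZeroCount T₂ : ℝ) - zetaZeroCount T₁ ≤
      (T₂ - T₁) / (2 * π) * Real.log (T₂ / (2 * π)) +
        (0.3083 * (Real.log T₁ + Real.log T₂) + 8.256) := by
  have hT₁0 : 0 < T₁ := by linarith
  have hT₂0 : 0 < T₂ := by linarith
  have e1 := abs_zetaZeroCount_sub_main_le_explicit h1
  have e2 := abs_zetaZeroCount_sub_main_le_explicit (h1.trans h12)
  rw [log_div_two_pi_e hT₁0] at e1
  rw [log_div_two_pi_e hT₂0] at e2
  have hm := rvmMain_sub_le hT₁0 h12
  obtain ⟨e1l, e1u⟩ := abs_le.1 e1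
  obtain ⟨e2l, e2u⟩ := abs_le.1 e2
  have r1 : T₁ / (2 * π) * (Real.log (T₁ / (2 * π)) - 1) =
      T₁ / (2 * π) * Real.log (T₁ / (2 * π)) - T₁ / (2 * π) := by ring
  have r2 : T₂ / (2 * π) * (Real.log (T₂ / (2 * π)) - 1) =
      T₂ / (2 * π) * Real.log (T₂ / (2 * π)) - T₂ / (2 * π) := by ring
  rw [r1] at e1l e1u
  rw [r2] at e2l e2u
  linarith

/-- **Explicit UNIT-WINDOW count** (`T ≥ 30`), the `C_w log T` input of the Landau–Gonek constant
(`exists_sum_zetaZeroWindow_le`, ZetaZerosJensen.lean:330, there an `∃ C`):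
`N(T+1) − N(T) ≤ (1/2π) log((T+1)/2π) + 0.6166 log(T+1) + 8.256 (≤ 0.78 log(T+1) + 8.3)`. -/
theorem zetaZeroCount_unit_window_le_explicit {T : ℝ} (hT : 30 ≤ T) :
    (zetaZeroCount (T + 1) : ℝ) - zetaZeroCount T ≤
      1 / (2 * π) * Real.log ((T + 1) / (2 * π)) + (0.6166 * Real.log (T + 1) + 8.256) := by
  have h := zetaZeroCount_window_upper_explicit hT (by linarith : T ≤ T + 1)
  have hlog : Real.log T ≤ Real.log (T + 1) := Real.log_le_log (by linarith) (by linarith)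
  have e : (T + 1 - T) / (2 * π) * Real.log ((T + 1) / (2 * π)) =
      1 / (2 * π) * Real.log ((T + 1) / (2 * π)) := by ring
  rw [e] at h
  linarith

/-- **The sharp Landau pairing window with EXPLICIT threshold `T* = 30`.**  Verbatim the tree's
`pairing_window_positive_sharp` (`IntegerScrewScrewPolyFloorLandauWindowSharp.lean`) with `T₀ := 30`: the height
threshold is discharged by the PROVED explicit zero count `abs_zetaZeroCount_sub_main_le_explicit`
(`|N(T) − (T/2π)log(T/2πe)| ≤ 0.3083 log T + 4.128`, `T ≥ 30`; Hasanalizade–Shen–Wong 2022); the only remaining `∃`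
is the pairing constant `C = max C_B 8`, `C_B` the threshold-free constant of `pairing_window_lower_bound_sharp`
(`= 124·C_L` of `landau_gonek_formula_sharp`).  RH-free, F1-free.  (Card SPLIT-screw-finite §11: residual T1‴ ↦ T1⁗ —
what remains of the pairing window is the block constant alone.) [folklore] -/
theorem pairing_window_positive_sharp_thirty :
    ∃ C : ℝ, 0 < C ∧ ∀ (M : ℕ), 1 ≤ M → ∀ (y : ℕ → ℝ) (T₁ T₂ : ℝ), 30 ≤ T₁ → T₁ ≤ T₂ →
      ((T₂ - T₁) / π * (Real.log (T₁ / (2 * π)) - Real.log M - 1) -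
          C * (Real.log T₂ + (M : ℝ) ^ 2 * Real.sqrt M * (Real.log T₂ ^ 2 + Real.log (3 * M)))) *
          ∑ m ∈ Icc 1 M, y m ^ 2 ≤
      ((∑ ρ ∈ (weilZeroIndex_finite T₂).toFinset, (riemannZetaZeroOrder ρ : ℂ) *
          ((∑ m ∈ Icc 1 M, (y m : ℂ) * (m : ℂ) ^ (ρ - 1 / 2)) *
            (∑ m ∈ Icc 1 M, (y m : ℂ) * (m : ℂ) ^ (-(ρ - 1 / 2))))) -
        ∑ ρ ∈ (weilZeroIndex_finite T₁).toFinset, (riemannZetaZeroOrder ρ : ℂ) *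
          ((∑ m ∈ Icc 1 M, (y m : ℂ) * (m : ℂ) ^ (ρ - 1 / 2)) *
            (∑ m ∈ Icc 1 M, (y m : ℂ) * (m : ℂ) ^ (-(ρ - 1 / 2))))).re := by
  obtain ⟨CB, hCB0, hB⟩ := pairing_window_lower_bound_sharp
  refine ⟨max CB 8, lt_max_of_lt_left hCB0, ?_⟩
  intro M hM y T₁ T₂ h1 h12
  have hT₁2 : 2 ≤ T₁ := by linarith
  have hT₁0 : 0 ≤ T₁ := by linarith
  have hT₂0 : 0 ≤ T₂ := by linarith
  have h := hB M hM y T₁ T₂ hT₁2 h12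
  have hn := zetaZeroCount_window_lower_four h1 h12
  rw [sum_order_eq_two_mul_zetaZeroCount hT₂0, sum_order_eq_two_mul_zetaZeroCount hT₁0] at h
  set S : ℝ := ∑ m ∈ Icc 1 M, y m ^ 2 with hS
  have hS0 : 0 ≤ S := Finset.sum_nonneg fun _ _ ↦ sq_nonneg _
  have hlog2 : 0 ≤ Real.log T₂ := Real.log_nonneg (by linarith)
  have hM1 : (1 : ℝ) ≤ M := by exact_mod_cast hM
  have hlam : 0 ≤ Real.log (3 * M) := Real.log_nonneg (by linarith)
  have hE0 : 0 ≤ (M : ℝ) ^ 2 * Real.sqrt M * (Real.log T₂ ^ 2 + Real.log (3 * M)) := by positivity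
  have hc1 : CB ≤ max CB 8 := le_max_left _ _
  have hc2 : (8 : ℝ) ≤ max CB 8 := le_max_right _ _
  have step1 : ((T₂ - T₁) / π * (Real.log (T₁ / (2 * π)) - Real.log M - 1) -
      max CB 8 * (Real.log T₂ + (M : ℝ) ^ 2 * Real.sqrt M * (Real.log T₂ ^ 2 + Real.log (3 * M)))) * S ≤
      ((2 * zetaZeroCount T₂ - 2 * zetaZeroCount T₁) * S - (T₂ - T₁) / π * (Real.log M + 1) * S -
        CB * (M : ℝ) ^ 2 * Real.sqrt M * (Real.log T₂ ^ 2 + Real.log (3 * M)) * S) := by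
    have hwin : (T₂ - T₁) / π * Real.log (T₁ / (2 * π)) - 8 * Real.log T₂ ≤
        2 * zetaZeroCount T₂ - 2 * zetaZeroCount T₁ := by
      have : (T₂ - T₁) / π * Real.log (T₁ / (2 * π)) =
          2 * ((T₂ - T₁) / (2 * π) * Real.log (T₁ / (2 * π))) := by
        ring
      rw [this]; linarith
    have hA : (T₂ - T₁) / π * (Real.log (T₁ / (2 * π)) - Real.log M - 1) -
        max CB 8 * (Real.log T₂ + (M : ℝ) ^ 2 * Real.sqrt M * (Real.log T₂ ^ 2 + Real.log (3 * M))) ≤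
        (2 * zetaZeroCount T₂ - 2 * zetaZeroCount T₁) - (T₂ - T₁) / π * (Real.log M + 1) -
          CB * (M : ℝ) ^ 2 * Real.sqrt M * (Real.log T₂ ^ 2 + Real.log (3 * M)) := by
      have p1 : CB * ((M : ℝ) ^ 2 * Real.sqrt M * (Real.log T₂ ^ 2 + Real.log (3 * M))) ≤
          max CB 8 * ((M : ℝ) ^ 2 * Real.sqrt M * (Real.log T₂ ^ 2 + Real.log (3 * M))) :=
        mul_le_mul_of_nonneg_right hc1 hE0
      have p2 : 8 * Real.log T₂ ≤ max CB 8 * Real.log T₂ := mul_le_mul_of_nonneg_right hc2 hlog2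
      have e : (T₂ - T₁) / π * (Real.log (T₁ / (2 * π)) - Real.log M - 1) =
          (T₂ - T₁) / π * Real.log (T₁ / (2 * π)) - (T₂ - T₁) / π * (Real.log M + 1) := by ring
      rw [e]
      nlinarith
    have := mul_le_mul_of_nonneg_right hA hS0
    nlinarith
  exact step1.trans h

end Summit.RiemannHypothesis.RiemannHypothesis.Theorems.IntegerScrewLandau.WindowThirty

end
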